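import Mathlib
import HarnessLib
import Literature.MathematicalPhysics.QuantumFieldTheory.YangMillsOS
import Summits.QuantumFields.YangMills.Theses.IsotropyFromPowerCounting
import Summits.QuantumFields.YangMills.Theorems.IsotropyFromPowerCountingCurvatureSandwichBoundDiagOfAxis

/-!
# Line `coupling-trichotomy` — crux stmt-QuantumFields-18372 `CurvatureSandwichBound` (Σ) (skeleton v6 DRAFT — folder only, NOT published/registered; line-writer seat, 2026-08-31; v5 0862f7fe1f07abf7 is the registry of record, RATIFIED R651-ym (3))

HONEST FRAMING (director-ym R645-ym, verbatim obligation). Route IsotropyFromPowerCounting (r4, the only route wanting Σ) concludes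
`YangMills` only through its `WeakCouplingHypercubicLimit`-type existence leg, which stays OPEN and summit-strength; this registered skeleton
is a typed plan for ONE leaf, not progress on the Clay problem; the Yang–Mills mass gap is NOT proved. The hardest stub below
(`stub_weakCouplingAxisRow`, v6: the AXIS ROW of Σ at weak coupling) contains the ultraviolet sandwich bound of the curvature channel at weak coupling — construction-level, PARKED, typed,
not claimed.

STATE OF THE LEAF (leads c1–c3, item evidence; skeleton of record `Lines/Sketch.lean` v4, 2026-08-17): the 45° rows of Σ follow from its axis
rows MODEL-BLINDLY (`Theorems.CurvatureSandwichBound.Sketch.sandwichRows_quarterTurn_of_sandwichRows`, corollary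
`curvatureSandwichBound_iff_axisRows`, p166596): Σ ⟺ its axis row. Every cut strictly BELOW the axis row tried so far is either model-blind —
refuted (random-constant-field inhabitant p172442, `ConvexityBarrier` p172808: no convex/positivity argument on `W1 ∧ EightFrameRP ∧ PlanarCone`
yields `μ < 4`) — or a k-uniform pair-scale lattice chain bound, i.e. the UV construction in sandwich currency; v4's single residual stub
`stub_chainGrowthAxis` is EQUIVALENT to the crux, so re-registering it alone would be costume by the letter. v4 also imports a dozen landed
Theorems modules whose hub oleans are UNBUILT today (rc 75 `remote:stale:…:unbuilt`), and its registered path was a swept session folder.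

THIS FILE (portable: imports only the route file + `YangMillsOS`) registers the one honest ≥ 2-piece cut that exists for Σ as typed — the
COUPLING TRICHOTOMY shared with crux K (stmt-11687, `Cruxes/CurvatureKernelBound/Lines/coupling_trichotomy.lean` v15): Σ quantifies over EVERY
species scheme `sch`; its hypothesis `W1 r sch S₁ = Tie ∧ OSPackage ∧ Translations ∧ Hypercubic ∧ Gaps` passes to subsequence schemes
(`latticeSchwinger` re-indexes definitionally; the lattice gap is eventual) and its conclusion (both sandwich rows) does not mention `sch`; every
real sequence `β_k` has a subsequence tending to `+∞`, to a real `b`, or to `−∞` (`EReal` sequentially compact). Hence, kernel-checked: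
`curvatureSandwichBound_of_children : WeakCoupling → FiniteCoupling → NegativeCoupling → <crux body>` and `CurvatureSandwichBound_of : CurvatureSandwichBound` (by name, from the three `stub_*`).
* `stub_weakCouplingAxisRow` (v6; v5 had `stub_weakCoupling` = both rows) — Σ's AXIS ROW for `sch.HasWeakCouplingLimit` (`β_k → +∞`): THE WALL; the 45° rows follow model-blindly (p166596, imported). bears_on: R2a. The only regime the route's `closes` feeds. Inside it only the
  AXIS ROW is open (p166596). [JaffeWitten2000 §6.5; Balaban1989LargeFieldII; MagnenRivasseauSeneor1993]
* `stub_finiteCoupling` — Σ for `β_k → b ∈ ℝ`: SCOPE ARTEFACT (continuum limits AT finite bare coupling). PLAN (hands-sized modulo the K bricks):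
  inside the strong-coupling disc `|b| < betaOne 4 r.ρ` the lead-c9–c11 bricks for K (Osterwalder–Seiler cluster expansion + swap RP + Hankel
  log-convexity, p156615 … p157183) identify every tempered / mildly-extensive `W1`-limit as an ULTRALOCAL product state, whose OS reconstruction is
  one-dimensional on `⁰𝒮`, so both sandwich rows hold trivially; residues as for K: hyper-extensive core and `betaOne ≤ |b|`. [OsterwalderSeiler1978;
  Schor1983; MontvayMunster1994 §3.7]
* `stub_negativeCoupling` — Σ for `β_k → −∞`: SCOPE ARTEFACT (frustrated Wilson coupling, no RP on odd tori). [Seiler1982]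
`sorry` occurs EXACTLY in the three `stub_*`. Negatives (stmt-9665/9494/9599/9603) and `Cruxes/CurvatureSandwichBound/Disproof.lean` /
`Theorems/CurvatureSandwichBound/Negative/*` (inhabitant zoo: every certified `W1`-inhabitant is ultralocal or free, where Σ holds): honoured — every
stub keeps `W1 ∧ EightFrameRP ∧ PlanarCone ∧ kernel` verbatim and adds a hypothesis on `sch.β` only (lattice data), so no model-blind claim is made.

v6 CHANGES (owed per R651-ym (3) / idea-crit-9 VERDICT #103 P3–P4; texts of children 2, 3 and all glue UNCHANGED from v5):
* + `import …Theorems.IsotropyFromPowerCountingCurvatureSandwichBoundDiagOfAxis` (p166596, BUILT); child 1 registered as `stub_weakCouplingAxisRow`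
  (`SandwichRows S₁` only); v5's both-rows child `WeakCoupling` is now the DERIVED theorem `weakCoupling_of_axisRow` (frame transfer
  `Sketch.sandwichRows_quarterTurn_of_sandwichRows`); composition `CurvatureSandwichBound_of` unchanged otherwise.
* ERRATUM to the v5 card (child 2 «tempered part hands-sized via the K-bricks p156615…p157183»): the K-bricks conclude K's KERNEL REPRESENTATION of
  `S₁ 2` at strong coupling — which is Σ's HYPOTHESIS `SoftKernel S₁`, not its conclusion; they discharge no part of Σ's child 2. A Σ-brick at strong
  coupling would need factorisation / clustering of the limit at EVERY degree (ultralocality of all `fieldVec`s, cf. `Negative/Unbundled` §1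
  «vacuum-only OS spaces satisfy the rows»), of which only degree 2 is landed (`TruncatedAxialPropagation`). Hence child 2 stays ONE stub
  (`stub_finiteCoupling`, scope artefact, 0 hands); nothing to import for it.
-/

noncomputable section

open scoped BigOperators Topology SchwartzMap
open MeasureTheory Filter Set
open Literature.MathematicalPhysics.QuantumLattice Literature.MathematicalPhysics.AQFT
  Literature.MathematicalPhysics.QuantumFieldTheory Literature.Probability.LatticeModels
  Summit.QuantumFields.YangMills.Theorems.CurvatureBoostCovariance.Negative
  Summit.QuantumFields.YangMills.Theorems.NPointIsotropy.Negative

namespace Summit.QuantumFields.YangMills.Cruxes.CurvatureSandwichBound.CouplingTrichotomy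

/-! ## The three children (crux body VERBATIM + one hypothesis on the bare coupling) -/

/-- Child 1 in AXIS-ROW FORM `WeakCouplingAxisRow` (v6, R651-ym (3) / idea-crit-9 #103 P3): Σ's `e₀`-frame rows `SandwichRows S₁` ONLY, for schemes
with `sch.HasWeakCouplingLimit` (`β_k → +∞`). THE WALL, stated literally as «the axis row of Σ at weak coupling»; the 45° rows follow MODEL-BLINDLY by the
landed quarter-turn transfer `sandwichRows_quarterTurn_of_sandwichRows` (p166596, `Theorems/IsotropyFromPowerCountingCurvatureSandwichBoundDiagOfAxis.lean`,
BUILT) — see `weakCoupling_of_axisRow` below. bears_on: R2a. [JaffeWitten2000 §6.5; Balaban1989LargeFieldII; MagnenRivasseauSeneor1993] -/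
def WeakCouplingAxisRow : Prop :=
  ∀ (G : Type) [Group G] [TopologicalSpace G] [IsTopologicalGroup G] [CompactSpace G] [MeasurableSpace G] [BorelSpace G], IsCompactSimpleLieGroup G → ∀ (r : LatticeRep G) (sch : SpeciesScheme (YMSpecies G)) (S₁ : SchwingerFamily E4), W1 r sch S₁ → sch.HasWeakCouplingLimit → EightFrameRP S₁ → PlanarCone S₁ → Summit.QuantumFields.YangMills.Theorems.SoftKernelBoostCovariance.Negative.SoftKernel S₁ → Summit.QuantumFields.YangMills.Theorems.CurvatureSandwichBound.Negative.SandwichRows S₁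

/-- Child 1, BOTH-ROWS form `WeakCoupling` (v5's registered child; in v6 it is DERIVED from `WeakCouplingAxisRow`, not a stub): Σ restricted to schemes with
`sch.HasWeakCouplingLimit` (`β_k → +∞`). [JaffeWitten2000 §6.5] -/
def WeakCoupling : Prop :=
  ∀ (G : Type) [Group G] [TopologicalSpace G] [IsTopologicalGroup G] [CompactSpace G] [MeasurableSpace G] [BorelSpace G], IsCompactSimpleLieGroup G → ∀ (r : LatticeRep G) (sch : SpeciesScheme (YMSpecies G)) (S₁ : SchwingerFamily E4), W1 r sch S₁ → sch.HasWeakCouplingLimit → EightFrameRP S₁ → PlanarCone S₁ → (∃ (K : E4 → ℝ) (C η : ℝ), 0 < η ∧ ContinuousOn K {x : E4 | x ≠ 0} ∧ (∀ x : E4, x ≠ 0 → |K x| ≤ C * (1 + ‖x‖ ^ (η - 10))) ∧ ∀ F : SchwartzMap (Fin 2 → E4) ℂ, IsOffDiagonal F → MeasureTheory.Integrable (fun x : Fin 2 → E4 => (K (x 0 - x 1) : ℂ) * F x) ∧ S₁ 2 F = ∫ x : Fin 2 → E4, (K (x 0 - x 1) : ℂ) * F x) → (∀ (h : OSReconstructionNoE1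 S₁.toLabelled), ∃ μ C : ℝ, μ < 4 ∧ (∀ (u v : ℝ), 0 < u → 0 < v → u ≤ 1 → v ≤ 1 → ∀ (f₁ : SchwartzMap (Fin 1 → E4) ℂ) (g hh : ℝ × ℝ → ℂ) (Mg Mh Mh' : ℝ), (∀ x : Fin 1 → E4, f₁ x = g (x 0 0, x 0 1) * hh (x 0 2, x 0 3)) → (∀ p : ℝ × ℝ, g p ≠ 0 → u ≤ p.1 ∧ p.1 ≤ 2 * u) → MeasureTheory.Integrable g → (∫ p, ‖g p‖) ≤ Mg → MeasureTheory.Integrable hh → (∫ p, ‖hh p‖) ≤ Mh → (∀ p, ‖hh p‖ ≤ Mh') → ∀ (n : ℕ) (W : SchwartzMap (Fin n → E4) ℂ) (hW : IsTimeOrdered W) (hFW : IsTimeOrdered (SchwartzMap.appendTensor f₁ (translateMulti ((2 * u + v) • EuclideanSpace.single 0 1) W))), ‖h.fieldVec (1 + n) (fun _ => ()) (SchwartzMap.appendTensor f₁ (translateMulti ((2 * u + v) • EuclideanSpace.single 0 1) W)) hFW‖ ≤ C * Mg * (Mh + Mh') * (u ^ (-μ) + v ^ (-μ)) * ‖h.fieldVec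 n (fun _ => ()) W hW‖)) ∧ (∀ (R : E4 ≃ₗᵢ[ℝ] E4), (∀ x : E4, R x 0 = Real.cos (Real.pi / 4) * x 0 + Real.sin (Real.pi / 4) * x 1 ∧ R x 1 = -Real.sin (Real.pi / 4) * x 0 + Real.cos (Real.pi / 4) * x 1 ∧ R x 2 = x 2 ∧ R x 3 = x 3) → ∀ (h' : OSReconstructionNoE1 (SchwingerFamily.toLabelled (fun n => (S₁ n).comp (linActMulti R)))), ∃ μ C : ℝ, μ < 4 ∧ (∀ (u v : ℝ), 0 < u → 0 < v → u ≤ 1 → v ≤ 1 → ∀ (f₁ : SchwartzMap (Fin 1 → E4) ℂ) (g hh : ℝ × ℝ → ℂ) (Mg Mh Mh' : ℝ), (∀ x : Fin 1 → E4, f₁ x = g (x 0 0, x 0 1) * hh (x 0 2, x 0 3)) → (∀ p : ℝ × ℝ, g p ≠ 0 → u ≤ p.1 ∧ p.1 ≤ 2 * u) → MeasureTheory.Integrable g → (∫ p, ‖g p‖) ≤ Mg → MeasureTheory.Integrable hh → (∫ p, ‖hh p‖) ≤ Mh → (∀ p, ‖hh p‖ ≤ Mh') → ∀ (n : ℕ)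 (W : SchwartzMap (Fin n → E4) ℂ) (hW : IsTimeOrdered W) (hFW : IsTimeOrdered (SchwartzMap.appendTensor f₁ (translateMulti ((2 * u + v) • EuclideanSpace.single 0 1) W))), ‖h'.fieldVec (1 + n) (fun _ => ()) (SchwartzMap.appendTensor f₁ (translateMulti ((2 * u + v) • EuclideanSpace.single 0 1) W)) hFW‖ ≤ C * Mg * (Mh + Mh') * (u ^ (-μ) + v ^ (-μ)) * ‖h'.fieldVec n (fun _ => ()) W hW‖))

/-- Child 2 `FiniteCoupling`: Σ restricted to schemes with `β_k → b ∈ ℝ`. Scope artefact. [OsterwalderSeiler1978] -/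
def FiniteCoupling : Prop :=
  ∀ (G : Type) [Group G] [TopologicalSpace G] [IsTopologicalGroup G] [CompactSpace G] [MeasurableSpace G] [BorelSpace G], IsCompactSimpleLieGroup G → ∀ (r : LatticeRep G) (sch : SpeciesScheme (YMSpecies G)) (S₁ : SchwingerFamily E4), W1 r sch S₁ → (∃ b : ℝ, Filter.Tendsto sch.β Filter.atTop (nhds b)) → EightFrameRP S₁ → PlanarCone S₁ → (∃ (K : E4 → ℝ) (C η : ℝ), 0 < η ∧ ContinuousOn K {x : E4 | x ≠ 0} ∧ (∀ x : E4, x ≠ 0 → |K x| ≤ C * (1 + ‖x‖ ^ (η - 10))) ∧ ∀ F : SchwartzMap (Fin 2 → E4) ℂ, IsOffDiagonal F → MeasureTheory.Integrable (fun x : Fin 2 → E4 => (K (x 0 - x 1) : ℂ) * F x) ∧ S₁ 2 F = ∫ x : Fin 2 → E4, (K (x 0 - x 1) : ℂ) * F x) → (∀ (h : OSReconstructionNoE1 S₁.toLabelled), ∃ μ C : ℝ, μ < 4 ∧ (∀ (u v : ℝ), 0 < u → 0 < v → u ≤ 1 → v ≤ 1 → ∀ (f₁ : SchwartzMap (Fin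 1 → E4) ℂ) (g hh : ℝ × ℝ → ℂ) (Mg Mh Mh' : ℝ), (∀ x : Fin 1 → E4, f₁ x = g (x 0 0, x 0 1) * hh (x 0 2, x 0 3)) → (∀ p : ℝ × ℝ, g p ≠ 0 → u ≤ p.1 ∧ p.1 ≤ 2 * u) → MeasureTheory.Integrable g → (∫ p, ‖g p‖) ≤ Mg → MeasureTheory.Integrable hh → (∫ p, ‖hh p‖) ≤ Mh → (∀ p, ‖hh p‖ ≤ Mh') → ∀ (n : ℕ) (W : SchwartzMap (Fin n → E4) ℂ) (hW : IsTimeOrdered W) (hFW : IsTimeOrdered (SchwartzMap.appendTensor f₁ (translateMulti ((2 * u + v) • EuclideanSpace.single 0 1) W))), ‖h.fieldVec (1 + n) (fun _ => ()) (SchwartzMap.appendTensor f₁ (translateMulti ((2 * u + v) • EuclideanSpace.single 0 1) W)) hFW‖ ≤ C * Mg * (Mh + Mh') * (u ^ (-μ) + v ^ (-μ)) * ‖h.fieldVec n (fun _ => ()) W hW‖)) ∧ (∀ (R : E4 ≃ₗᵢ[ℝ] E4), (∀ x : E4, R x 0 = Real.cos (Real.pi / 4) * x 0 + Real.sin (Real.pi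 / 4) * x 1 ∧ R x 1 = -Real.sin (Real.pi / 4) * x 0 + Real.cos (Real.pi / 4) * x 1 ∧ R x 2 = x 2 ∧ R x 3 = x 3) → ∀ (h' : OSReconstructionNoE1 (SchwingerFamily.toLabelled (fun n => (S₁ n).comp (linActMulti R)))), ∃ μ C : ℝ, μ < 4 ∧ (∀ (u v : ℝ), 0 < u → 0 < v → u ≤ 1 → v ≤ 1 → ∀ (f₁ : SchwartzMap (Fin 1 → E4) ℂ) (g hh : ℝ × ℝ → ℂ) (Mg Mh Mh' : ℝ), (∀ x : Fin 1 → E4, f₁ x = g (x 0 0, x 0 1) * hh (x 0 2, x 0 3)) → (∀ p : ℝ × ℝ, g p ≠ 0 → u ≤ p.1 ∧ p.1 ≤ 2 * u) → MeasureTheory.Integrable g → (∫ p, ‖g p‖) ≤ Mg → MeasureTheory.Integrable hh → (∫ p, ‖hh p‖) ≤ Mh → (∀ p, ‖hh p‖ ≤ Mh') → ∀ (n : ℕ) (W : SchwartzMap (Fin n → E4) ℂ) (hW : IsTimeOrdered W) (hFW : IsTimeOrdered (SchwartzMap.appendTensor f₁ (translateMulti ((2 * u + v) • EuclideanSpace.single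 0 1) W))), ‖h'.fieldVec (1 + n) (fun _ => ()) (SchwartzMap.appendTensor f₁ (translateMulti ((2 * u + v) • EuclideanSpace.single 0 1) W)) hFW‖ ≤ C * Mg * (Mh + Mh') * (u ^ (-μ) + v ^ (-μ)) * ‖h'.fieldVec n (fun _ => ()) W hW‖))

/-- Child 3 `NegativeCoupling`: Σ restricted to schemes with `β_k → −∞`. Scope artefact. [Seiler1982] -/
def NegativeCoupling : Prop :=
  ∀ (G : Type) [Group G] [TopologicalSpace G] [IsTopologicalGroup G] [CompactSpace G] [MeasurableSpace G] [BorelSpace G], IsCompactSimpleLieGroup G → ∀ (r : LatticeRep G) (sch : SpeciesScheme (YMSpecies G)) (S₁ : SchwingerFamily E4), W1 r sch S₁ → Filter.Tendsto sch.β Filter.atTop Filter.atBot → EightFrameRP S₁ → PlanarCone S₁ → (∃ (K : E4 → ℝ) (C η : ℝ), 0 < η ∧ ContinuousOn K {x : E4 | x ≠ 0} ∧ (∀ x : E4, x ≠ 0 → |K x| ≤ C * (1 + ‖x‖ ^ (η - 10))) ∧ ∀ F : SchwartzMap (Fin 2 → E4) ℂ, IsOffDiagonal F → MeasureTheory.Integrable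 (fun x : Fin 2 → E4 => (K (x 0 - x 1) : ℂ) * F x) ∧ S₁ 2 F = ∫ x : Fin 2 → E4, (K (x 0 - x 1) : ℂ) * F x) → (∀ (h : OSReconstructionNoE1 S₁.toLabelled), ∃ μ C : ℝ, μ < 4 ∧ (∀ (u v : ℝ), 0 < u → 0 < v → u ≤ 1 → v ≤ 1 → ∀ (f₁ : SchwartzMap (Fin 1 → E4) ℂ) (g hh : ℝ × ℝ → ℂ) (Mg Mh Mh' : ℝ), (∀ x : Fin 1 → E4, f₁ x = g (x 0 0, x 0 1) * hh (x 0 2, x 0 3)) → (∀ p : ℝ × ℝ, g p ≠ 0 → u ≤ p.1 ∧ p.1 ≤ 2 * u) → MeasureTheory.Integrable g → (∫ p, ‖g p‖) ≤ Mg → MeasureTheory.Integrable hh → (∫ p, ‖hh p‖) ≤ Mh → (∀ p, ‖hh p‖ ≤ Mh') → ∀ (n : ℕ) (W : SchwartzMap (Fin n → E4) ℂ) (hW : IsTimeOrdered W) (hFW : IsTimeOrdered (SchwartzMap.appendTensor f₁ (translateMulti ((2 * u + v) • EuclideanSpace.single 0 1) W))), ‖h.fieldVec (1 + n) (fun _ =>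 ()) (SchwartzMap.appendTensor f₁ (translateMulti ((2 * u + v) • EuclideanSpace.single 0 1) W)) hFW‖ ≤ C * Mg * (Mh + Mh') * (u ^ (-μ) + v ^ (-μ)) * ‖h.fieldVec n (fun _ => ()) W hW‖)) ∧ (∀ (R : E4 ≃ₗᵢ[ℝ] E4), (∀ x : E4, R x 0 = Real.cos (Real.pi / 4) * x 0 + Real.sin (Real.pi / 4) * x 1 ∧ R x 1 = -Real.sin (Real.pi / 4) * x 0 + Real.cos (Real.pi / 4) * x 1 ∧ R x 2 = x 2 ∧ R x 3 = x 3) → ∀ (h' : OSReconstructionNoE1 (SchwingerFamily.toLabelled (fun n => (S₁ n).comp (linActMulti R)))), ∃ μ C : ℝ, μ < 4 ∧ (∀ (u v : ℝ), 0 < u → 0 < v → u ≤ 1 → v ≤ 1 → ∀ (f₁ : SchwartzMap (Fin 1 → E4) ℂ) (g hh : ℝ × ℝ → ℂ) (Mg Mh Mh' : ℝ), (∀ x : Fin 1 → E4, f₁ x = g (x 0 0, x 0 1) * hh (x 0 2, x 0 3)) → (∀ p : ℝ × ℝ, g p ≠ 0 → u ≤ p.1 ∧ p.1 ≤ 2 *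 u) → MeasureTheory.Integrable g → (∫ p, ‖g p‖) ≤ Mg → MeasureTheory.Integrable hh → (∫ p, ‖hh p‖) ≤ Mh → (∀ p, ‖hh p‖ ≤ Mh') → ∀ (n : ℕ) (W : SchwartzMap (Fin n → E4) ℂ) (hW : IsTimeOrdered W) (hFW : IsTimeOrdered (SchwartzMap.appendTensor f₁ (translateMulti ((2 * u + v) • EuclideanSpace.single 0 1) W))), ‖h'.fieldVec (1 + n) (fun _ => ()) (SchwartzMap.appendTensor f₁ (translateMulti ((2 * u + v) • EuclideanSpace.single 0 1) W)) hFW‖ ≤ C * Mg * (Mh + Mh') * (u ^ (-μ) + v ^ (-μ)) * ‖h'.fieldVec n (fun _ => ()) W hW‖))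

/-! ## Registered stubs `stub_<name>` (`sorry` lives ONLY here) -/

/-- **stub_weakCouplingAxisRow** = child 1 in axis-row form (OPEN — THE WALL: the `e₀`-frame UV sandwich rows of the curvature channel for asymptotically free schemes = exactly what is open after p166596; parked, typed, not claimed; bears_on: R2a). Size XL (open problem). [JaffeWitten2000 §6.5; Balaban1989LargeFieldII; MagnenRivasseauSeneor1993] -/
theorem stub_weakCouplingAxisRow : WeakCouplingAxisRow := by
  sorry

theorem stub_finiteCoupling : FiniteCoupling := by
  sorry

/-- **stub_negativeCoupling** = child 3 (OPEN; scope artefact: `β_k → −∞`). Size L. [Seiler1982] -/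
theorem stub_negativeCoupling : NegativeCoupling := by
  sorry

/-! ## Glue (kernel-checked; no `sorry` below this line) -/

/-- **v6: both rows from the axis row** (model-blind frame transfer, landed p166596): `WeakCouplingAxisRow → WeakCoupling` — for each datum the
`e₀`-frame rows give the rows of the quarter-turn pull-back by `sandwichRows_quarterTurn_of_sandwichRows` (OS package and translations from `W1`). [folklore] -/
theorem weakCoupling_of_axisRow (h : WeakCouplingAxisRow) : WeakCoupling := by
  intro G _ _ _ _ _ _ hG r sch S₁ hW hweak h8 hC hK
  have hax := h G hG r sch S₁ hW hweak h8 hC hK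
  exact ⟨hax, fun R hR =>
    Summit.QuantumFields.YangMills.Theorems.CurvatureSandwichBound.Sketch.sandwichRows_quarterTurn_of_sandwichRows S₁ hW.2.1 hW.2.2.1 hax R hR⟩

/-- **Coupling trichotomy along a subsequence.** Every real sequence has a subsequence tending to
`+∞`, or to `-∞`, or to a real number (sequential compactness of `EReal`). [folklore] -/
theorem exists_subseq_coupling_trichotomy : ∀ (u : ℕ → ℝ), ∃ φ : ℕ → ℕ, StrictMono φ ∧ (Filter.Tendsto (fun k => u (φ k)) Filter.atTop Filter.atTop ∨ Filter.Tendsto (fun k => u (φ k)) Filter.atTop Filter.atBot ∨ ∃ b : ℝ, Filter.Tendsto (fun k => u (φ k)) Filter.atTop (nhds b)) := by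
  intro u
  obtain ⟨x, φ, hφ, hx⟩ := CompactSpace.tendsto_subseq (fun k => ((u k : ℝ) : EReal))
  refine ⟨φ, hφ, ?_⟩
  induction x using EReal.rec with
  | bot =>
    refine Or.inr (Or.inl ?_)
    have h : Tendsto (fun k => ((u (φ k) : ℝ) : EReal)) atTop (𝓝 ⊥) := hx
    exact EReal.tendsto_coe_nhds_bot_iff.1 h
  | coe b =>
    refine Or.inr (Or.inr ⟨b, ?_⟩)
    have h : Tendsto (fun k => ((u (φ k) : ℝ) : EReal)) atTop (𝓝 (b : EReal)) := hx
    exact EReal.tendsto_coe.1 h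
  | top =>
    refine Or.inl ?_
    have h : Tendsto (fun k => ((u (φ k) : ℝ) : EReal)) atTop (𝓝 ⊤) := hx
    exact EReal.tendsto_coe_nhds_top_iff.1 h

/-- **Sub-schemes exist**: along a strictly increasing `φ` there is a scheme (all data composed with
`φ`) whose lattice `n`-point functions of the curvature are the re-indexed ones (definitionally),
whose couplings are `β ∘ φ`, and which keeps every uniform lattice mass gap. [folklore] -/
theorem exists_subseqScheme {G : Type} [Group G] [TopologicalSpace G] [IsTopologicalGroup G]
    [CompactSpace G] [MeasurableSpace G] [BorelSpace G] (r : LatticeRep G)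
    (sch : SpeciesScheme (YMSpecies G)) (φ : ℕ → ℕ) (hφ : StrictMono φ) :
    ∃ sch' : SpeciesScheme (YMSpecies G),
      (∀ (k n : ℕ) (f : Fin n → 𝓢(EuclideanSpace ℝ (Fin 4), ℝ)),
          latticeSchwinger r.ρ sch' (fun s => s.F) k n (fun _ => r.curvature) f =
            latticeSchwinger r.ρ sch (fun s => s.F) (φ k) n (fun _ => r.curvature) f) ∧
        (sch'.β = fun k => sch.β (φ k)) ∧
        ∀ Δ : ℝ, HasLatticeMassGap r sch Δ → HasLatticeMassGap r sch' Δ := by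
  refine ⟨{ a := fun k => sch.a (φ k)
            a_pos := fun k => sch.a_pos (φ k)
            tendsto_a := sch.tendsto_a.comp hφ.tendsto_atTop
            β := fun k => sch.β (φ k)
            L := fun k => sch.L (φ k)
            tendsto_L := sch.tendsto_L.comp hφ.tendsto_atTop
            c := fun s k => sch.c s (φ k)
            m := fun s k => sch.m s (φ k) }, fun _ _ _ => rfl, rfl, ?_⟩
  intro Δ h A B
  obtain ⟨C, hC⟩ := h A B
  exact ⟨C, hφ.tendsto_atTop.eventually hC⟩


/-- The unbundled package `W1` passes to subsequence schemes. [folklore] -/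
theorem W1_subseq {G : Type} [Group G] [TopologicalSpace G] [IsTopologicalGroup G] [CompactSpace G]
    [MeasurableSpace G] [BorelSpace G] (r : LatticeRep G) (sch : SpeciesScheme (YMSpecies G))
    (S₁ : SchwingerFamily E4) (hW1 : W1 r sch S₁) (φ : ℕ → ℕ) (hφ : StrictMono φ) :
    ∃ sch' : SpeciesScheme (YMSpecies G), W1 r sch' S₁ ∧ sch'.β = fun k => sch.β (φ k) := by
  obtain ⟨sch', hls, hβ, hgap'⟩ := exists_subseqScheme r sch φ hφ
  refine ⟨sch', ?_, hβ⟩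
  unfold W1 Tie Gaps at hW1 ⊢
  obtain ⟨htie, hos, htr, hhyp, Δ, hΔ, hgap, hlat⟩ := hW1
  refine ⟨?_, hos, htr, hhyp, Δ, hΔ, hgap, hgap' Δ hlat⟩
  intro n hn f F hF hoff
  have h := (htie n hn f F hF hoff).comp hφ.tendsto_atTop
  refine h.congr (fun k => ?_)
  simp only [Function.comp_apply, hls]

/-- **The split, literal form**: the three children imply the crux body VERBATIM — pass to a subsequence scheme in one of the three
coupling regimes (`W1` is subsequence-invariant; the conclusion does not mention the scheme). [folklore] -/
theorem curvatureSandwichBound_of_children (hW : WeakCoupling) (hF : FiniteCoupling) (hN : NegativeCoupling) :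
    (∀ (G : Type) [Group G] [TopologicalSpace G] [IsTopologicalGroup G] [CompactSpace G] [MeasurableSpace G] [BorelSpace G], IsCompactSimpleLieGroup G → ∀ (r : LatticeRep G) (sch : SpeciesScheme (YMSpecies G)) (S₁ : SchwingerFamily E4), W1 r sch S₁ → EightFrameRP S₁ → PlanarCone S₁ → (∃ (K : E4 → ℝ) (C η : ℝ), 0 < η ∧ ContinuousOn K {x : E4 | x ≠ 0} ∧ (∀ x : E4, x ≠ 0 → |K x| ≤ C * (1 + ‖x‖ ^ (η - 10))) ∧ ∀ F : SchwartzMap (Fin 2 → E4) ℂ, IsOffDiagonal F → MeasureTheory.Integrable (fun x : Fin 2 → E4 => (K (x 0 - x 1) : ℂ) * F x) ∧ S₁ 2 F = ∫ x : Fin 2 → E4, (K (x 0 - x 1) : ℂ) * F x) → (∀ (h : OSReconstructionNoE1 S₁.toLabelled), ∃ μ C : ℝ, μ < 4 ∧ (∀ (u v : ℝ), 0 < u → 0 < v → u ≤ 1 → v ≤ 1 → ∀ (f₁ : SchwartzMap (Fin 1 → E4) ℂ) (g hh : ℝ × ℝ → ℂ) (Mg Mh Mh' : ℝ), (∀ x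 : Fin 1 → E4, f₁ x = g (x 0 0, x 0 1) * hh (x 0 2, x 0 3)) → (∀ p : ℝ × ℝ, g p ≠ 0 → u ≤ p.1 ∧ p.1 ≤ 2 * u) → MeasureTheory.Integrable g → (∫ p, ‖g p‖) ≤ Mg → MeasureTheory.Integrable hh → (∫ p, ‖hh p‖) ≤ Mh → (∀ p, ‖hh p‖ ≤ Mh') → ∀ (n : ℕ) (W : SchwartzMap (Fin n → E4) ℂ) (hW : IsTimeOrdered W) (hFW : IsTimeOrdered (SchwartzMap.appendTensor f₁ (translateMulti ((2 * u + v) • EuclideanSpace.single 0 1) W))), ‖h.fieldVec (1 + n) (fun _ => ()) (SchwartzMap.appendTensor f₁ (translateMulti ((2 * u + v) • EuclideanSpace.single 0 1) W)) hFW‖ ≤ C * Mg * (Mh + Mh') * (u ^ (-μ) + v ^ (-μ)) * ‖h.fieldVec n (fun _ => ()) W hW‖)) ∧ (∀ (R : E4 ≃ₗᵢ[ℝ] E4), (∀ x : E4, R x 0 = Real.cos (Real.pi / 4) * x 0 + Real.sin (Real.pi / 4) * x 1 ∧ R x 1 = -Real.sin (Real.pi / 4) * x 0 + Real.cos (Real.pi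 / 4) * x 1 ∧ R x 2 = x 2 ∧ R x 3 = x 3) → ∀ (h' : OSReconstructionNoE1 (SchwingerFamily.toLabelled (fun n => (S₁ n).comp (linActMulti R)))), ∃ μ C : ℝ, μ < 4 ∧ (∀ (u v : ℝ), 0 < u → 0 < v → u ≤ 1 → v ≤ 1 → ∀ (f₁ : SchwartzMap (Fin 1 → E4) ℂ) (g hh : ℝ × ℝ → ℂ) (Mg Mh Mh' : ℝ), (∀ x : Fin 1 → E4, f₁ x = g (x 0 0, x 0 1) * hh (x 0 2, x 0 3)) → (∀ p : ℝ × ℝ, g p ≠ 0 → u ≤ p.1 ∧ p.1 ≤ 2 * u) → MeasureTheory.Integrable g → (∫ p, ‖g p‖) ≤ Mg → MeasureTheory.Integrable hh → (∫ p, ‖hh p‖) ≤ Mh → (∀ p, ‖hh p‖ ≤ Mh') → ∀ (n : ℕ) (W : SchwartzMap (Fin n → E4) ℂ) (hW : IsTimeOrdered W) (hFW : IsTimeOrdered (SchwartzMap.appendTensor f₁ (translateMulti ((2 * u + v) • EuclideanSpace.single 0 1) W))), ‖h'.fieldVec (1 + n) (fun _ => ()) (SchwartzMap.appendTensor f₁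 (translateMulti ((2 * u + v) • EuclideanSpace.single 0 1) W)) hFW‖ ≤ C * Mg * (Mh + Mh') * (u ^ (-μ) + v ^ (-μ)) * ‖h'.fieldVec n (fun _ => ()) W hW‖))) := by
  intro G _ _ _ _ _ _ hG r sch S₁ hW1
  obtain ⟨φ, hφ, hcase⟩ := exists_subseq_coupling_trichotomy sch.β
  obtain ⟨sch', hW1', hβ⟩ := W1_subseq r sch S₁ hW1 φ hφ
  have hcase' : Tendsto sch'.β atTop atTop ∨ Tendsto sch'.β atTop atBot ∨
      ∃ b : ℝ, Tendsto sch'.β atTop (𝓝 b) := by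
    rw [hβ]; exact hcase
  rcases hcase' with htop | hbot | ⟨b, hb⟩
  · exact hW G hG r sch' S₁ hW1' htop
  · exact hN G hG r sch' S₁ hW1' hbot
  · exact hF G hG r sch' S₁ hW1' ⟨b, hb⟩

/-- **Composition `CurvatureSandwichBound_of`**: the registered stubs `stub_weakCouplingAxisRow → stub_finiteCoupling → stub_negativeCoupling` give (v6: child 1 through `weakCoupling_of_axisRow`)
the crux BY NAME (the ONLY theorem in this file whose conclusion is the crux decl, so the skeleton audit is unambiguous). [folklore] -/
theorem CurvatureSandwichBound_of : Summit.QuantumFields.YangMills.Theses.IsotropyFromPowerCounting.CurvatureSandwichBound :=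
  curvatureSandwichBound_of_children (weakCoupling_of_axisRow stub_weakCouplingAxisRow) stub_finiteCoupling stub_negativeCoupling

/-- Sanity (each child is WEAKER than the crux): the crux implies all three children. [folklore] -/
theorem children_of_crux (h : Summit.QuantumFields.YangMills.Theses.IsotropyFromPowerCounting.CurvatureSandwichBound) :
    WeakCoupling ∧ FiniteCoupling ∧ NegativeCoupling := by
  refine ⟨?_, ?_, ?_⟩ <;> intro G _ _ _ _ _ _ hG r sch S₁ hW1 _ <;> exact h G hG r sch S₁ hW1

/-- Sanity: the crux implies the axis-row child (drop the 45° conjunct). [folklore] -/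
theorem weakCouplingAxisRow_of_crux (h : Summit.QuantumFields.YangMills.Theses.IsotropyFromPowerCounting.CurvatureSandwichBound) :
    WeakCouplingAxisRow := by
  intro G _ _ _ _ _ _ hG r sch S₁ hW1 _ h8 hC hK
  exact (h G hG r sch S₁ hW1 h8 hC hK).1

end Summit.QuantumFields.YangMills.Cruxes.CurvatureSandwichBound.CouplingTrichotomy

end
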